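import Literature.NumberTheory.Transcendental.BinomialAntiEFunctionODE
import Literature.NumberTheory.Transcendental.BinomialAntiEFunctionShift
import HarnessLib

/-!
# Fischler–Rivoal's Corollary 1 — the operators: the equation of `𝔤 = β − 𝔣(cz)`, its order-2 annihilator `N`, and the non-rationality of `𝔣(cz)`

`Literature/NumberTheory/Transcendental/FischlerRivoalCorollary1Operators.lean` — everything
PROVED. Third proofs file of the named fact `FischlerRivoal2024_corollary1`
(`FischlerRivoalCorollary1.lean`), preparing the formal Beukers-type deduction of
`FischlerRivoalCorollary1OfAndre.lean`. With `𝔥(z) = 𝔣(cz) = ∑ n! C(s,n) cⁿ zⁿ`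
(`antiESeries (chooseSeq s c)`, `c = α⁻¹`) and `𝔤 = β − 𝔥` (`antiESeries (β δ₀ − chooseSeq s c)`):

* §1 `antiESeries_chooseSeq_ode`, `antiESeries_diffSeq_ode` — `c z² 𝔥′ + (1 − scz) 𝔥 = 1` and
  `c z² 𝔤′ + (1 − scz) 𝔤 = ρ := (1 − scz)β − 1` in `ℂ⟦z⟧` ("`𝔣` is solution of the inhomogeneous
  differential equation `z²𝔣′(z) + (1−sz)𝔣(z) − 1 = 0`", after `z ↦ cz`);
* §2 `antiESeries_chooseSeq_not_ratFunc` — `Q·𝔥 = P` with polynomials forces `Q = 0` (`c ≠ 0`,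
  `s ∉ ℤ_{≥0}`): "`𝔣(z)` is a transcendental function because `s ∉ ℤ_{≥0}`";
* §3 (`namespace FischlerRivoalCor1`) the polynomials `rho`, `nTwo`, `nOne`, `nZero` of the
  order-2 operator `N = ρ·∂∘E − ρ′·E`, `E = cz²∂ + (1 − scz)`, the identity `nOp_eq` valid in
  EVERY differential `ℂ[z]`-algebra (so that `N` kills `𝔤` in `ℂ⟦z⟧`, `nOp_antiESeries_diffSeq`,
  and the local solution `zˢe^{1/(cz)}` at `z = 1`, `nOp_eq_zero_of_E_eq_zero`), `ρ ≠ 0`,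
  `n₂ ≠ 0`.

## References

* [FischlerRivoal2024] S. Fischler, T. Rivoal, J. Number Theory 261 (2024), §5.1–5.2.
-/

noncomputable section

open Finset Complex
open scoped Nat

namespace Literature.NumberTheory.Transcendental


open Literature.Barriers.Schanuel Literature.RingTheory.Binomial Polynomial

variable (s : ℚ) (c β : ℂ)

/-! ### 1. The rescaled binomial Э-function `𝔥(z) = 𝔣(cz) = ∑ n! C(s,n) cⁿ zⁿ` -/

/-- The recurrence `hₙ₊₁ = c (s − n) hₙ` for the coefficients `hₙ = n! C(s,n) cⁿ` of `𝔣(cz)`. [folklore] -/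
theorem coeff_antiESeries_chooseSeq_succ (n : ℕ) :
    PowerSeries.coeff (n + 1) (antiESeries (chooseSeq s c)) =
      c * ((s : ℂ) - n) * PowerSeries.coeff n (antiESeries (chooseSeq s c)) := by
  rw [coeff_antiESeries, coeff_antiESeries, Nat.factorial_succ]
  have := chooseSeq_succ s c n
  push_cast
  linear_combination (n ! : ℂ) * this

/-- `h₀ = 1`. [folklore] -/
theorem coeff_zero_antiESeries_chooseSeq :
    PowerSeries.coeff 0 (antiESeries (chooseSeq s c)) = 1 := by
  simp [coeff_antiESeries, chooseSeq]

/-- No coefficient of `𝔣(cz)` vanishes when `c ≠ 0` and `s ∉ ℤ_{≥0}`. [folklore] -/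
theorem coeff_antiESeries_chooseSeq_ne_zero (hc : c ≠ 0) (hs : ∀ n : ℕ, (s : ℚ) ≠ n) (n : ℕ) :
    PowerSeries.coeff n (antiESeries (chooseSeq s c)) ≠ 0 := by
  induction n with
  | zero => rw [coeff_zero_antiESeries_chooseSeq]; exact one_ne_zero
  | succ n ih =>
    rw [coeff_antiESeries_chooseSeq_succ]
    refine mul_ne_zero (mul_ne_zero hc (sub_ne_zero.2 ?_)) ih
    intro h
    exact hs n (by exact_mod_cast h)

/-- Coefficients of `c X² f′ + (1 − sc X) f`: index `n+1`. [folklore] -/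
theorem coeff_succ_rescaledODE_lhs (f : PowerSeries ℂ) (n : ℕ) :
    PowerSeries.coeff (n + 1) (PowerSeries.C c * PowerSeries.X ^ 2 * PowerSeries.derivative ℂ f
      + (1 - PowerSeries.C ((s : ℂ) * c) * PowerSeries.X) * f) =
      PowerSeries.coeff (n + 1) f - c * ((s : ℂ) - n) * PowerSeries.coeff n f := by
  rw [map_add, sub_mul, one_mul, map_sub, mul_assoc, mul_assoc, PowerSeries.coeff_C_mul,
    PowerSeries.coeff_C_mul, PowerSeries.coeff_succ_X_mul, pow_two, mul_assoc]
  rcases n with _ | n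
  · rw [PowerSeries.coeff_succ_X_mul, PowerSeries.coeff_zero_X_mul]
    simp only [mul_zero, Nat.cast_zero, sub_zero, zero_add, PowerSeries.coeff_zero_eq_constantCoeff]
    ring
  · rw [PowerSeries.coeff_succ_X_mul, PowerSeries.coeff_succ_X_mul, PowerSeries.coeff_derivative]
    push_cast
    ring

/-- Coefficients of `c X² f′ + (1 − sc X) f`: index `0`. [folklore] -/
theorem coeff_zero_rescaledODE_lhs (f : PowerSeries ℂ) :
    PowerSeries.coeff 0 (PowerSeries.C c * PowerSeries.X ^ 2 * PowerSeries.derivative ℂ f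
      + (1 - PowerSeries.C ((s : ℂ) * c) * PowerSeries.X) * f) = PowerSeries.coeff 0 f := by
  rw [map_add, sub_mul, one_mul, map_sub, mul_assoc, mul_assoc, PowerSeries.coeff_C_mul,
    PowerSeries.coeff_C_mul, PowerSeries.coeff_zero_X_mul, pow_two, mul_assoc,
    PowerSeries.coeff_zero_X_mul]
  simp

/-- **`c z² 𝔥′ + (1 − scz) 𝔥 = 1`** for `𝔥(z) = 𝔣(cz) = ∑ n! C(s,n) cⁿ zⁿ` (the equation of
[FischlerRivoal2024, §5.2] after `z ↦ cz`). PROVED. [cite: FischlerRivoal2024, §5.2] -/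
theorem antiESeries_chooseSeq_ode :
    PowerSeries.C c * PowerSeries.X ^ 2 * PowerSeries.derivative ℂ (antiESeries (chooseSeq s c))
      + (1 - PowerSeries.C ((s : ℂ) * c) * PowerSeries.X) * antiESeries (chooseSeq s c) = 1 := by
  ext n
  rcases n with _ | n
  · rw [coeff_zero_rescaledODE_lhs, coeff_zero_antiESeries_chooseSeq, PowerSeries.coeff_one]
    simp
  · rw [coeff_succ_rescaledODE_lhs, coeff_antiESeries_chooseSeq_succ, sub_self,
      PowerSeries.coeff_one]
    simp

/-- The Э-series of `gₙ = β δₙ₀ − C(s,n)cⁿ` is `β − 𝔥`. [folklore] -/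
theorem antiESeries_diffSeq :
    antiESeries (fun n => β * deltaZero n - chooseSeq s c n) =
      PowerSeries.C β - antiESeries (chooseSeq s c) := by
  ext n
  rw [map_sub, coeff_antiESeries, coeff_antiESeries, PowerSeries.coeff_C]
  rcases n with _ | n
  · simp
  · simp [deltaZero_of_ne_zero (Nat.succ_ne_zero n)]

/-- **The inhomogeneous equation of `𝔤 = β − 𝔥`**: `c z² 𝔤′ + (1 − scz) 𝔤 = (1 − scz)β − 1`.
PROVED. [cite: FischlerRivoal2024, §5.2] -/
theorem antiESeries_diffSeq_ode :
    PowerSeries.C c * PowerSeries.X ^ 2 *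
        PowerSeries.derivative ℂ (antiESeries fun n => β * deltaZero n - chooseSeq s c n)
      + (1 - PowerSeries.C ((s : ℂ) * c) * PowerSeries.X)
        * antiESeries (fun n => β * deltaZero n - chooseSeq s c n) =
      (1 - PowerSeries.C ((s : ℂ) * c) * PowerSeries.X) * PowerSeries.C β - 1 := by
  have h := antiESeries_chooseSeq_ode s c
  rw [antiESeries_diffSeq, map_sub, PowerSeries.derivative_C, zero_sub, mul_sub]
  linear_combination -h

/-! ### 2. `𝔥` is not a rational function (`c ≠ 0`, `s ∉ ℤ_{≥0}`) -/

/-- **`𝔣(cz)` is not a rational function**: `Q · 𝔥 = P` with polynomials forces `Q = 0`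
(`c ≠ 0`, `s ∉ ℤ_{≥0}`; the ratio `hₙ₊₁/hₙ = c(s−n)` is unbounded and no `hₙ` vanishes, while
rational series have geometrically bounded coefficients). PROVED. [cite: FischlerRivoal2024, §5.2] -/
theorem antiESeries_chooseSeq_not_ratFunc (hc : c ≠ 0) (hs : ∀ n : ℕ, (s : ℚ) ≠ n)
    {P Q : Polynomial ℂ}
    (h : (Q : PowerSeries ℂ) * antiESeries (chooseSeq s c) = P) : Q = 0 := by
  set f := antiESeries (chooseSeq s c) with hf
  induction hd : Q.natDegree using Nat.strong_induction_on generalizing P Q with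
  | _ d ih =>
    by_contra hQ
    by_cases hQ0 : Q.coeff 0 = 0
    · have hQeq : Q = Q.divX * Polynomial.X := by
        have := Polynomial.divX_mul_X_add Q
        rw [hQ0, map_zero, add_zero] at this
        exact this.symm
      have hP0 : P.coeff 0 = 0 := by
        have := congrArg (PowerSeries.coeff 0) h
        rw [hQeq, Polynomial.coe_mul, Polynomial.coe_X, mul_assoc, mul_comm, mul_assoc,
          PowerSeries.coeff_zero_X_mul, Polynomial.coeff_coe] at this
        exact this.symm
      have hPeq : P = P.divX * Polynomial.X := by
        have := Polynomial.divX_mul_X_add P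
        rw [hP0, map_zero, add_zero] at this
        exact this.symm
      have h' : ((Q.divX : Polynomial ℂ) : PowerSeries ℂ) * f = (P.divX : Polynomial ℂ) := by
        have hX : (PowerSeries.X : PowerSeries ℂ) ≠ 0 := PowerSeries.X_ne_zero
        apply mul_right_cancel₀ hX
        have := h
        rw [hQeq, hPeq, Polynomial.coe_mul, Polynomial.coe_mul, Polynomial.coe_X] at this
        calc ((Q.divX : Polynomial ℂ) : PowerSeries ℂ) * f * PowerSeries.X
            = ((Q.divX : Polynomial ℂ) : PowerSeries ℂ) * PowerSeries.X * f := by ring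
          _ = ((P.divX : Polynomial ℂ) : PowerSeries ℂ) * PowerSeries.X := this
      have hdivX : Q.divX ≠ 0 := by
        intro h0
        apply hQ
        rw [hQeq, h0, zero_mul]
      have hlt : Q.divX.natDegree < d := by
        rw [← hd, Polynomial.natDegree_divX_eq_natDegree_tsub_one]
        have : Q.natDegree ≠ 0 := by
          intro h0
          apply hdivX
          rw [Polynomial.divX_eq_zero_iff]
          exact Polynomial.eq_C_of_natDegree_eq_zero h0
        omega
      exact hdivX (ih _ hlt h' rfl)
    · obtain ⟨A, B, hA1, hB1, hbound⟩ := exists_geometric_bound_of_polynomial_mul_eq hQ0 h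
      have hne := coeff_antiESeries_chooseSeq_ne_zero s c hc hs
      have hrec := coeff_antiESeries_chooseSeq_succ s c
      have hc0 : 0 < ‖c‖ := norm_pos_iff.2 hc
      obtain ⟨N, hN⟩ := exists_nat_ge (‖(s : ℂ)‖ + 2 * B / ‖c‖)
      have hB0 : 0 < B := by linarith
      have hgrow : ∀ j, (2 * B) ^ j * ‖PowerSeries.coeff N f‖ ≤ ‖PowerSeries.coeff (N + j) f‖ := by
        intro j
        induction j with
        | zero => simp
        | succ j ihj =>
          rw [← Nat.add_assoc, hf, hrec, ← hf, norm_mul, norm_mul, pow_succ]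
          push_cast
          have hsn : 2 * B ≤ ‖c‖ * ‖(s : ℂ) - ((N : ℂ) + (j : ℂ))‖ := by
            have h1 : ‖(N : ℂ) + (j : ℂ)‖ - ‖(s : ℂ)‖ ≤ ‖(s : ℂ) - ((N : ℂ) + (j : ℂ))‖ := by
              rw [norm_sub_rev]; exact norm_sub_norm_le _ _
            have h2 : ‖(N : ℂ) + (j : ℂ)‖ = (N : ℝ) + j := by
              rw [show (N : ℂ) + (j : ℂ) = ((N + j : ℕ) : ℂ) by push_cast; ring,
                Complex.norm_natCast]
              push_cast
              ring
            have hj0 : (0 : ℝ) ≤ j := Nat.cast_nonneg j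
            have h3 : 2 * B / ‖c‖ ≤ (N : ℝ) + j - ‖(s : ℂ)‖ := by linarith
            have h4 : 2 * B ≤ ‖c‖ * ((N : ℝ) + j - ‖(s : ℂ)‖) := by
              rw [div_le_iff₀ hc0] at h3; linarith
            exact h4.trans (mul_le_mul_of_nonneg_left (by linarith) hc0.le)
          calc (2 * B) ^ j * (2 * B) * ‖PowerSeries.coeff N f‖
              = 2 * B * ((2 * B) ^ j * ‖PowerSeries.coeff N f‖) := by ring
            _ ≤ ‖c‖ * ‖(s : ℂ) - ((N : ℂ) + (j : ℂ))‖ * ‖PowerSeries.coeff (N + j) f‖ :=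
              mul_le_mul hsn ihj (by positivity) (by positivity)
      have hN0 : 0 < ‖PowerSeries.coeff N f‖ := norm_pos_iff.2 (hne N)
      have hall : ∀ j : ℕ, (2 : ℝ) ^ j * ‖PowerSeries.coeff N f‖ ≤ A * B ^ N := by
        intro j
        have h1 := (hgrow j).trans (hbound (N + j))
        rw [mul_pow, pow_add] at h1
        have hBj : 0 < B ^ j := pow_pos hB0 j
        have h2 : ((2 : ℝ) ^ j * ‖PowerSeries.coeff N f‖) * B ^ j ≤ (A * B ^ N) * B ^ j := by
          nlinarith
        exact le_of_mul_le_mul_right h2 hBj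
      obtain ⟨j, hj⟩ := pow_unbounded_of_one_lt (A * B ^ N / ‖PowerSeries.coeff N f‖) one_lt_two
      have := hall j
      rw [div_lt_iff₀ hN0] at hj
      linarith

/-! ### 3. The order-2 operator `N = ρ·∂∘E − ρ′·E` annihilating `𝔤` -/

namespace FischlerRivoalCor1

/-- `ρ = (1 − sc X) β − 1`, the right-hand side of the inhomogeneous equation of `𝔤 = β − 𝔥`.
[cite: FischlerRivoal2024, §5.2] -/
def rho (s : ℚ) (c β : ℂ) : Polynomial ℂ :=
  (1 - Polynomial.C ((s : ℂ) * c) * Polynomial.X) * Polynomial.C β - 1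

/-- Leading coefficient `n₂ = ρ · cX²` of `N`. [cite: FischlerRivoal2024, §5.2] -/
def nTwo (s : ℚ) (c β : ℂ) : Polynomial ℂ :=
  rho s c β * (Polynomial.C c * Polynomial.X ^ 2)

/-- Coefficient `n₁ = ρ·((cX²)′ + (1 − scX)) − ρ′·cX²` of `N`. [cite: FischlerRivoal2024, §5.2] -/
def nOne (s : ℚ) (c β : ℂ) : Polynomial ℂ :=
  rho s c β * (derivative (Polynomial.C c * Polynomial.X ^ 2)
      + (1 - Polynomial.C ((s : ℂ) * c) * Polynomial.X))
    - derivative (rho s c β) * (Polynomial.C c * Polynomial.X ^ 2)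

/-- Coefficient `n₀ = ρ·(1 − scX)′ − ρ′·(1 − scX)` of `N`. [cite: FischlerRivoal2024, §5.2] -/
def nZero (s : ℚ) (c β : ℂ) : Polynomial ℂ :=
  rho s c β * derivative (1 - Polynomial.C ((s : ℂ) * c) * Polynomial.X)
    - derivative (rho s c β) * (1 - Polynomial.C ((s : ℂ) * c) * Polynomial.X)

/-- `ρ ≠ 0` (as `s, c ≠ 0`: if `β = 0` then `ρ = −1`, else its `X`-coefficient is `−scβ ≠ 0`).
[folklore] -/
theorem rho_ne_zero (hc : c ≠ 0) (hs : ∀ n : ℕ, (s : ℚ) ≠ n) : rho s c β ≠ 0 := by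
  have hs0 : (s : ℂ) ≠ 0 := by
    have := hs 0
    exact_mod_cast this
  intro h
  by_cases hβ : β = 0
  · have := congrArg (fun p => Polynomial.coeff p 0) h
    simp [rho, hβ] at this
  · have := congrArg (fun p => Polynomial.coeff p 1) h
    simp [rho, Polynomial.coeff_one, Polynomial.coeff_C] at this
    rcases this with (h3 | h3) | h3
    · exact hs0 (by exact_mod_cast h3)
    · exact hc h3
    · exact hβ h3

/-- `n₂ ≠ 0`. [folklore] -/
theorem nTwo_ne_zero (hc : c ≠ 0) (hs : ∀ n : ℕ, (s : ℚ) ≠ n) : nTwo s c β ≠ 0 := by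
  refine mul_ne_zero (rho_ne_zero s c β hc hs) (mul_ne_zero ?_ (pow_ne_zero _ Polynomial.X_ne_zero))
  simpa using hc

/-- **`N = ρ·∂∘E − ρ′·E` in every differential `ℂ[X]`-algebra**: with
`E(y) = cX²·y′ + (1 − scX)·y`, `n₂ y″ + n₁ y′ + n₀ y = ρ·(E y)′ − ρ′·(E y)`. Hence every `y`
with `E(y)` equal to `ρ` (as `𝔤` in `ℂ⟦z⟧`) or to `0` (as the local solution `zˢe^{1/(cz)}`) is
annihilated by `N`. PROVED. [cite: FischlerRivoal2024, §5.2] -/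
theorem nOp_eq {A : Type*} [CommRing A] (ι : Polynomial ℂ →+* A) (D : A →+ A)
    (hD : ∀ a b, D (a * b) = D a * b + a * D b) (hι : ∀ p, D (ι p) = ι (derivative p)) (y : A) :
    ι (nTwo s c β) * D (D y) + ι (nOne s c β) * D y + ι (nZero s c β) * y =
      ι (rho s c β) * D (ι (Polynomial.C c * Polynomial.X ^ 2) * D y
          + ι (1 - Polynomial.C ((s : ℂ) * c) * Polynomial.X) * y)
        - ι (derivative (rho s c β)) * (ι (Polynomial.C c * Polynomial.X ^ 2) * D y
          + ι (1 - Polynomial.C ((s : ℂ) * c) * Polynomial.X) * y) := by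
  have hD1 : D 1 = 0 := by
    have := hD 1 1
    rw [mul_one, one_mul] at this
    linear_combination -this
  simp only [nTwo, nOne, nZero, map_add, map_sub, map_mul, map_neg, map_one, map_zero, hD, hι, hD1,
    Polynomial.derivative_mul, Polynomial.derivative_C, Polynomial.derivative_X,
    Polynomial.derivative_X_sq, Polynomial.derivative_one,
    zero_mul, mul_zero, add_zero, zero_add, mul_one, zero_sub]
  ring

/-- If `E(y) = ι ρ` then `N(y) = 0`. [folklore] -/
theorem nOp_eq_zero_of_E_eq_rho {A : Type*} [CommRing A] (ι : Polynomial ℂ →+* A) (D : A →+ A)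
    (hD : ∀ a b, D (a * b) = D a * b + a * D b) (hι : ∀ p, D (ι p) = ι (derivative p)) {y : A}
    (hE : ι (Polynomial.C c * Polynomial.X ^ 2) * D y
      + ι (1 - Polynomial.C ((s : ℂ) * c) * Polynomial.X) * y = ι (rho s c β)) :
    ι (nTwo s c β) * D (D y) + ι (nOne s c β) * D y + ι (nZero s c β) * y = 0 := by
  rw [nOp_eq s c β ι D hD hι, hE, hι]
  ring

/-- If `E(y) = 0` then `N(y) = 0`. [folklore] -/
theorem nOp_eq_zero_of_E_eq_zero {A : Type*} [CommRing A] (ι : Polynomial ℂ →+* A) (D : A →+ A)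
    (hD : ∀ a b, D (a * b) = D a * b + a * D b) (hι : ∀ p, D (ι p) = ι (derivative p)) {y : A}
    (hE : ι (Polynomial.C c * Polynomial.X ^ 2) * D y
      + ι (1 - Polynomial.C ((s : ℂ) * c) * Polynomial.X) * y = 0) :
    ι (nTwo s c β) * D (D y) + ι (nOne s c β) * D y + ι (nZero s c β) * y = 0 := by
  rw [nOp_eq s c β ι D hD hι, hE, map_zero]
  ring

end FischlerRivoalCor1

/-- **`𝔤` solves `N`** in `ℂ⟦z⟧` (with `ι` the coercion `ℂ[z] → ℂ⟦z⟧`, `D = d/dz`). PROVED.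
[cite: FischlerRivoal2024, §5.2] -/
theorem nOp_antiESeries_diffSeq :
    ((FischlerRivoalCor1.nTwo s c β : Polynomial ℂ) : PowerSeries ℂ)
        * PowerSeries.derivative ℂ (PowerSeries.derivative ℂ
            (antiESeries fun n => β * deltaZero n - chooseSeq s c n))
      + ((FischlerRivoalCor1.nOne s c β : Polynomial ℂ) : PowerSeries ℂ)
        * PowerSeries.derivative ℂ (antiESeries fun n => β * deltaZero n - chooseSeq s c n)
      + ((FischlerRivoalCor1.nZero s c β : Polynomial ℂ) : PowerSeries ℂ)
        * (antiESeries fun n => β * deltaZero n - chooseSeq s c n) = 0 := by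
  have h := FischlerRivoalCor1.nOp_eq_zero_of_E_eq_rho s c β
    (Polynomial.coeToPowerSeries.ringHom : Polynomial ℂ →+* PowerSeries ℂ)
    (PowerSeries.derivative ℂ : PowerSeries ℂ →ₗ[ℂ] PowerSeries ℂ).toAddMonoidHom
    (fun a b => by
      show PowerSeries.derivative ℂ (a * b) =
        PowerSeries.derivative ℂ a * b + a * PowerSeries.derivative ℂ b
      rw [(PowerSeries.derivative ℂ).leibniz, smul_eq_mul, smul_eq_mul]; ring)
    (fun p => by
      show PowerSeries.derivative ℂ (p : PowerSeries ℂ) = ((derivative p : Polynomial ℂ) : PowerSeries ℂ)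
      exact PowerSeries.derivative_coe p)
    (y := antiESeries fun n => β * deltaZero n - chooseSeq s c n) ?_
  · simpa using h
  · have := antiESeries_diffSeq_ode s c β
    simp only [Polynomial.coeToPowerSeries.ringHom_apply, Polynomial.coe_mul, Polynomial.coe_C,
      Polynomial.coe_pow, Polynomial.coe_X, Polynomial.coe_sub, Polynomial.coe_one,
      LinearMap.toAddMonoidHom_coe, FischlerRivoalCor1.rho]
    exact this

end Literature.NumberTheory.Transcendental

end
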